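import Mathlib
import Summits.NavierStokesRegularity.NavierStokesRegularity.Theorems.LevelSetModerationHighSpeedPressureWorkPairingWindow
import Summits.NavierStokesRegularity.NavierStokesRegularity.Theorems.LevelSetModerationHighSpeedPressureWorkCostCauchySchwarz
import Summits.NavierStokesRegularity.NavierStokesRegularity.Theorems.LevelSetModerationHighSpeedPressureWorkEarlyWindow

/-!
# Route LevelSetModeration — `HighSpeedPressureWork`: the Hölder pairing bound

Support file for item stmt-NavierStokesRegularity-18149 (`HighSpeedPressureWork`). The crux asks for
the pairing law `PW_c(t) ≤ √(F M^m V_c(T)) √(D_c(T))` for the pressure work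
`PW_c(t) = -∫₀ᵗ∫ (1 - c/|u|)₊ D(p̃[u τ])(u)` on super-level sets of the speed
(`V_c = ∫|{c<|u|}|`, `D_c = ∫∫ 1_{c<|u|} ‖D|u|‖²`), and is kernel-pinned as
`UniformBound ∧ stub_earlyBookkeeping` (`…CruxAnatomy`): a class-uniform speed bound plus the same
pairing law in the early window `t ≤ cₑ ν/B₀²` at the levels `c ∈ [B₀, 2B₀)`. This file proves the
**Hölder pairing bound**: for every `q > 2` there is `C_q` with

  `PW_c(t) ≤ √(C_q G^{4-4/q} E^{2/q} t^{2/q} V_c(t)^{1-2/q}) · √(D_c(T))`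

for every classical Leray–Hopf solution with `∫|u₀|² ≤ E` and every speed bound `|u| ≤ G` on
`(0,t) × ℝ³` (`levelSetModeration_pairing_le_holder`), and hence — with the speed bound `2B₀` of the
early window — UNCONDITIONALLY in the early window, at every level `c > 0`
(`levelSetModeration_earlyPairing_le_holder`). Against the registered early law
`√(F(E₀,B₀) V_c(T)) √(D_c(T))` the only loss is the factor `(t / V_c)^{1/q}`, `q < ∞` arbitrary:
the early-window debt of the crux can fail only along fast sets whose volume fraction `V_c(t)/t`
tends to zero, and then slower than every power (the `L^∞`/BMO endpoint of the Calderón–Zygmund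
scale, where `p̃` is unbounded on nested-shell configurations). Under a class-uniform speed bound
`G(E₀,B₀)` the same bound holds on the whole horizon, so the `V^{1/2-1/q}`-weakening of the crux is
implied by `UniformBound` alone.

Proof: moderated Cauchy–Schwarz on the window with `Φ = 0` and the slice bound
`∫ 1_A p̃² ≤ C_q² G^{4-4/q} E^{2/q} |A|^{1-2/q}` (`…PairingWindow`), then Hölder in time
`∫₀ᵗ |A_τ|^{1-2/q} dτ ≤ V_c(t)^{1-2/q} t^{2/q}`.
-/

noncomputable section

-- single-conjunct summit: `Summit.<Summit>.<Problem>` repeats the name by the D-0017 layout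
set_option linter.dupNamespace false

namespace Summit.NavierStokesRegularity.NavierStokesRegularity.Theorems

open MeasureTheory Set Filter Topology Function
open scoped ENNReal NNReal RealInnerProductSpace
open Literature.Analysis.FluidPDE

/-! ### The Hölder pairing bound on a window under a speed bound -/

/-- **The Hölder pairing bound.** For every exponent `q > 2` there is a constant `C = C(q) ≥ 0`
such that for every classical solution of unforced Navier–Stokes on `ℝ³ × [0,T)` (`ν, T > 0`),
Leray–Hopf from a rapidly decaying datum with `∫|u₀|² ≤ E`, every level `c > 0`, every
`t ∈ [0,T)` and every speed bound `|u| ≤ G` on `(0,t) × ℝ³`: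

  `-∫₀ᵗ∫ (1 - c/|u|)₊ D(p̃[u τ])(u) ≤ √(C G^{4-4/q} E^{2/q} t^{2/q} V_c(t)^{1-2/q}) · √(D_c(T))`,

`V_c(t) = ∫₀ᵗ |{c < |u(τ)|}| dτ`, `D_c(T) = ∫₀ᵀ∫ 1_{c<|u|} ‖D|u|‖²`. Compared with the pairing
law `√(F V_c) √(D_c)` of the crux `HighSpeedPressureWork` the loss is exactly the factor
`(E t /(G² V_c(t)))^{1/q} G²`-type power `V_c^{-1/q} t^{1/q}`: the pairing law can fail only
along fast sets of vanishing volume fraction `V_c(t)/t → 0`, at a rate slower than every power.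
Proof: moderated Cauchy–Schwarz on the window with `Φ = 0`
(`levelSetModeration_pairing_le_sqrt_moderated`), the slice bound
`∫ 1_A p̃² ≤ C_q² G^{4-4/q} E^{2/q} |A|^{1-2/q}` (`levelSetModeration_fastSetPressureSq_le`, Stein's
`L^q` bound for the Riesz transforms and interpolation `L² ∩ L^∞ ⊂ L^{2q}`) and Hölder in time
`∫₀ᵗ |A_τ|^{1-2/q} ≤ V_c(t)^{1-2/q} t^{2/q}`. [cite: Stein1971, Ch. II §4.2 Thm 3 (b)] -/
theorem levelSetModeration_pairing_le_holder {q : ℝ} (hq : 2 < q) :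
    ∃ C : ℝ, 0 ≤ C ∧ ∀ (ν T : ℝ) (u : ℝ → EuclideanSpace ℝ (Fin 3) → EuclideanSpace ℝ (Fin 3))
      (p : ℝ → EuclideanSpace ℝ (Fin 3) → ℝ), 0 < ν → 0 < T →
      IsClassicalNSSolutionOn (Ico 0 T) ν 0 u p → IsLerayHopfOn T ν 0 (u 0) u →
      HasRapidSpatialDecay (u 0) →
      ∀ (E G c t : ℝ), (∫ x, ‖u 0 x‖ ^ 2) ≤ E → 0 ≤ G → 0 < c → t ∈ Ico 0 T →
      (∀ τ ∈ Ioo 0 t, ∀ x, ‖u τ x‖ ≤ G) →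
      -(∫ τ in Ioo 0 t, ∫ x, max (1 - c / ‖u τ x‖) 0 *
          (fderiv ℝ (normalisedPressure (u τ)) x (u τ x))) ≤
        Real.sqrt (C * G ^ (4 - 4 / q) * E ^ (2 / q) * t ^ (2 / q) *
            (∫⁻ τ in Ioo 0 t, volume {x | c < ‖u τ x‖}).toReal ^ (1 - 2 / q)) *
          Real.sqrt ((∫⁻ τ in Ioo 0 T, ∫⁻ x, {x | c < ‖u τ x‖}.indicator
            (fun x => ENNReal.ofReal (‖fderiv ℝ (fun y => ‖u τ y‖) x‖ ^ 2)) x).toReal) := by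
  have hq0 : 0 < q := by linarith
  have hθ0 : 0 < 1 - 2 / q := by rw [sub_pos, div_lt_one hq0]; exact hq
  have h2q : 0 < 2 / q := by positivity
  have hθ1 : 1 - 2 / q < 1 := by linarith
  obtain ⟨C₀, hC₀⟩ := levelSetModeration_fastSetPressureSq_le hq
  refine ⟨(C₀ : ℝ) ^ 2, sq_nonneg _, ?_⟩
  intro ν T u p hν hT hcl hLH hdec E G c t hE hG hc ht hbd
  have hE0 : 0 ≤ E := (integral_nonneg fun x => sq_nonneg _).trans hE
  -- notation
  set Psl : ℝ → ℝ≥0∞ := fun τ => ∫⁻ x, {x | c < ‖u τ x‖}.indicator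
      (fun x => ENNReal.ofReal (normalisedPressure (u τ) x ^ 2)) x with hPsl
  set Vt : ℝ≥0∞ := ∫⁻ τ in Ioo 0 t, volume {x | c < ‖u τ x‖} with hVt
  set K : ℝ≥0∞ := (C₀ : ℝ≥0∞) ^ (2 : ℝ) * ENNReal.ofReal G ^ (4 - 4 / q) *
      ENNReal.ofReal E ^ (2 / q) with hK
  have h4q : 0 ≤ 4 - 4 / q := by
    have : 4 / q ≤ 2 := by rw [div_le_iff₀ hq0]; linarith
    linarith
  have hKfin : K ≠ ⊤ := by
    refine ENNReal.mul_ne_top (ENNReal.mul_ne_top ?_ ?_) ?_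
    · exact ENNReal.rpow_ne_top_of_nonneg (by norm_num) ENNReal.coe_ne_top
    · exact ENNReal.rpow_ne_top_of_nonneg h4q ENNReal.ofReal_ne_top
    · exact ENNReal.rpow_ne_top_of_nonneg (by positivity) ENNReal.ofReal_ne_top
  -- (1) slice bound `Psl τ ≤ K |A_τ|^{1-2/q}` for `τ ∈ (0,t)`
  have hslice : ∀ τ ∈ Ioo 0 t, Psl τ ≤ K * volume {x | c < ‖u τ x‖} ^ (1 - 2 / q) := by
    intro τ hτ
    have hτ' : τ ∈ Ico 0 T := ⟨hτ.1.le, hτ.2.trans ht.2⟩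
    have hτc : τ ∈ Icc 0 T := ⟨hτ.1.le, (hτ.2.trans ht.2).le⟩
    have hmeasw : AEStronglyMeasurable (u τ) volume := (hLH.memLp τ hτc).1
    have hE₂ : (∫⁻ x, ‖u τ x‖ₑ ^ 2) ≤ ENNReal.ofReal E :=
      (lintegral_enorm_sq_le_of_lerayHopf hLH hν.le hτc).trans (ENNReal.ofReal_le_ofReal hE)
    have hE₂fin : (∫⁻ x, ‖u τ x‖ₑ ^ 2) ≠ ⊤ := ne_top_of_le_ne_top ENNReal.ofReal_ne_top hE₂
    have hA : MeasurableSet {x | c < ‖u τ x‖} :=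
      (isOpen_lt continuous_const (hcl.contDiff_velocity hτ').continuous.norm).measurableSet
    have h := hC₀ (u τ) hmeasw hE₂fin G (hbd τ hτ) {x | c < ‖u τ x‖} hA
    refine h.trans ?_
    rw [hK]
    gcongr
  -- (2) time integration and Hölder in time
  have hcontu : ContinuousOn (uncurry u) (Ico 0 T ×ˢ univ) := hcl.smooth_velocity.continuousOn
  have hVmeas : AEMeasurable (fun τ => volume {x | c < ‖u τ x‖}) (volume.restrict (Ioo 0 t)) :=
    levelSetModeration_aemeasurable_volume_superlevel hcontu c ht.2.le
  have hHtime : ∫⁻ τ in Ioo 0 t, volume {x | c < ‖u τ x‖} ^ (1 - 2 / q) ≤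
      Vt ^ (1 - 2 / q) * ENNReal.ofReal t ^ (2 / q) := by
    have h := levelSetModeration_lintegral_rpow_mul_rpow_le (volume.restrict (Ioo 0 t)) hVmeas
      (aemeasurable_const : AEMeasurable (fun _ => (1 : ℝ≥0∞)) _) hθ0 hθ1
    simp only [ENNReal.one_rpow, mul_one, lintegral_const, Measure.restrict_apply MeasurableSet.univ,
      univ_inter, Real.volume_Ioo, sub_zero, one_mul] at h
    have hexp : 1 - (1 - 2 / q) = 2 / q := by ring
    rw [hexp] at h
    exact h
  have hX : ∫⁻ τ in Ioo 0 t, Psl τ ≤ K * (Vt ^ (1 - 2 / q) * ENNReal.ofReal t ^ (2 / q)) := by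
    calc ∫⁻ τ in Ioo 0 t, Psl τ ≤ ∫⁻ τ in Ioo 0 t, K * volume {x | c < ‖u τ x‖} ^ (1 - 2 / q) := by
          refine lintegral_mono_ae ?_
          filter_upwards [ae_restrict_mem measurableSet_Ioo] with τ hτ
          exact hslice τ hτ
      _ = K * ∫⁻ τ in Ioo 0 t, volume {x | c < ‖u τ x‖} ^ (1 - 2 / q) :=
          lintegral_const_mul' _ _ hKfin
      _ ≤ K * (Vt ^ (1 - 2 / q) * ENNReal.ofReal t ^ (2 / q)) := by gcongr
  have hVtfin : Vt ≠ ⊤ := by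
    refine ne_top_of_le_ne_top (levelSetModeration_highSetMeasure_ne_top hν.le hLH hc) ?_
    exact lintegral_mono_set (Ioo_subset_Ioo le_rfl ht.2.le)
  have hRfin : K * (Vt ^ (1 - 2 / q) * ENNReal.ofReal t ^ (2 / q)) ≠ ⊤ :=
    ENNReal.mul_ne_top hKfin (ENNReal.mul_ne_top (ENNReal.rpow_ne_top_of_nonneg hθ0.le hVtfin)
      (ENNReal.rpow_ne_top_of_nonneg (by positivity) ENNReal.ofReal_ne_top))
  have hXfin : ∫⁻ τ in Ioo 0 t, Psl τ ≠ ⊤ := ne_top_of_le_ne_top hRfin hX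
  -- (3) moderated Cauchy–Schwarz on the window with `Φ = 0`
  have hΦ : Continuous (uncurry fun (_ : ℝ) (_ : ℝ) => (0 : ℝ)) := continuous_const
  have hmod := levelSetModeration_pairing_le_sqrt_moderated hν hT hcl hLH hdec hc ht hΦ
  simp only [sub_zero] at hmod
  have hmain := hmod hXfin
  -- (4) the real form of the majorant
  have hreal : (K * (Vt ^ (1 - 2 / q) * ENNReal.ofReal t ^ (2 / q))).toReal =
      (C₀ : ℝ) ^ 2 * G ^ (4 - 4 / q) * E ^ (2 / q) * t ^ (2 / q) * Vt.toReal ^ (1 - 2 / q) := by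
    rw [hK, ENNReal.toReal_mul, ENNReal.toReal_mul, ENNReal.toReal_mul, ENNReal.toReal_mul,
      ← ENNReal.toReal_rpow, ← ENNReal.toReal_rpow, ← ENNReal.toReal_rpow, ← ENNReal.toReal_rpow,
      ← ENNReal.toReal_rpow, ENNReal.toReal_ofReal hG, ENNReal.toReal_ofReal hE0,
      ENNReal.toReal_ofReal ht.1, ENNReal.coe_toReal, Real.rpow_two]
    ring
  have hsqrt : Real.sqrt (∫⁻ τ in Ioo 0 t, Psl τ).toReal ≤
      Real.sqrt ((C₀ : ℝ) ^ 2 * G ^ (4 - 4 / q) * E ^ (2 / q) * t ^ (2 / q) * Vt.toReal ^ (1 - 2 / q)) := by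
    rw [← hreal]
    exact Real.sqrt_le_sqrt (ENNReal.toReal_mono hRfin hX)
  exact hmain.trans (mul_le_mul_of_nonneg_right hsqrt (Real.sqrt_nonneg _))

/-! ### The early window: the unconditional form -/

/-- **The Hölder pairing bound in the early window, unconditionally.** For every `q > 2` there are
`C ≥ 0` and an absolute `ε > 0` such that every classical Leray–Hopf solution on `ℝ³ × [0,T)` from
a rapidly decaying datum with `∫|u₀|² ≤ E₀`, `|u₀| ≤ B₀` (`B₀ > 0`) satisfies, for every level
`c > 0` and every `t ∈ [0,T)` with `t ≤ ε ν / B₀²`,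

  `-∫₀ᵗ∫ (1 - c/|u|)₊ D(p̃[u τ])(u) ≤ √(C B₀^{4-4/q} E₀^{2/q} t^{2/q} V_c(T)^{1-2/q}) · √(D_c(T))`

(the speed bound `|u| ≤ 2B₀` of the early window, `levelSetModeration_earlyWindow`, fed into
`levelSetModeration_pairing_le_holder`). This is the registered early-window law
`stub_earlyBookkeeping` of the crux `HighSpeedPressureWork` — `√(F(E₀,B₀) V_c(T)) √(D_c(T))` for
`c ∈ [B₀, 2B₀)`, `t ≤ cₑ ν/B₀²` — up to the factor `(t/V_c(T))^{1/q}` for an arbitrary `q < ∞`, and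
at every level `c > 0`. [cite: Stein1971, Ch. II §4.2 Thm 3 (b)] -/
theorem levelSetModeration_earlyPairing_le_holder {q : ℝ} (hq : 2 < q) :
    ∃ C ε : ℝ, 0 ≤ C ∧ 0 < ε ∧ ∀ (ν T : ℝ)
      (u : ℝ → EuclideanSpace ℝ (Fin 3) → EuclideanSpace ℝ (Fin 3))
      (p : ℝ → EuclideanSpace ℝ (Fin 3) → ℝ), 0 < ν → 0 < T →
      IsClassicalNSSolutionOn (Ico 0 T) ν 0 u p → IsLerayHopfOn T ν 0 (u 0) u →
      HasRapidSpatialDecay (u 0) →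
      ∀ (E₀ B₀ : ℝ), (∫ x, ‖u 0 x‖ ^ 2) ≤ E₀ → 0 < B₀ → (∀ x, ‖u 0 x‖ ≤ B₀) →
      ∀ (c t : ℝ), 0 < c → t ∈ Ico 0 T → t ≤ ε * ν / B₀ ^ 2 →
      -(∫ τ in Ioo 0 t, ∫ x, max (1 - c / ‖u τ x‖) 0 *
          (fderiv ℝ (normalisedPressure (u τ)) x (u τ x))) ≤
        Real.sqrt (C * B₀ ^ (4 - 4 / q) * E₀ ^ (2 / q) * t ^ (2 / q) *
            (∫⁻ τ in Ioo 0 T, volume {x | c < ‖u τ x‖}).toReal ^ (1 - 2 / q)) *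
          Real.sqrt ((∫⁻ τ in Ioo 0 T, ∫⁻ x, {x | c < ‖u τ x‖}.indicator
            (fun x => ENNReal.ofReal (‖fderiv ℝ (fun y => ‖u τ y‖) x‖ ^ 2)) x).toReal) := by
  have hq0 : 0 < q := by linarith
  have hθ0 : 0 ≤ 1 - 2 / q := by rw [sub_nonneg, div_le_one hq0]; exact hq.le
  have h4q : 4 - 4 / q ≤ 4 := by have : 0 ≤ 4 / q := by positivity
                                 linarith
  have h4q' : 0 ≤ 4 - 4 / q := by
    have : 4 / q ≤ 2 := by rw [div_le_iff₀ hq0]; linarith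
    linarith
  obtain ⟨c₀, hc₀, hEW⟩ := levelSetModeration_earlyWindow
  obtain ⟨C, hC0, hC⟩ := levelSetModeration_pairing_le_holder hq
  refine ⟨16 * C, c₀ / 2, by positivity, by positivity, ?_⟩
  intro ν T u p hν hT hcl hLH hdec E₀ B₀ hE₀ hB₀ hbd c t hc ht htε
  have hE0 : 0 ≤ E₀ := (integral_nonneg fun x => sq_nonneg _).trans hE₀
  -- the speed bound `2B₀` on `(0, t)`
  have hG : ∀ τ ∈ Ioo 0 t, ∀ x, ‖u τ x‖ ≤ 2 * B₀ := by
    intro τ hτ x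
    have hτ' : τ ∈ Ico 0 T := ⟨hτ.1.le, hτ.2.trans ht.2⟩
    have hτc : τ < c₀ * ν / B₀ ^ 2 := by
      have h1 : c₀ / 2 * ν / B₀ ^ 2 < c₀ * ν / B₀ ^ 2 := by
        rw [div_lt_div_iff_of_pos_right (by positivity)]
        nlinarith
      exact hτ.2.trans_le (htε.trans h1.le)
    exact (hEW ν T u p hν hT hcl hLH hdec B₀ hB₀ hbd τ hτ' hτc).1 x
  have hmain := hC ν T u p hν hT hcl hLH hdec E₀ (2 * B₀) c t hE₀ (by positivity) hc ht hG
  refine hmain.trans (mul_le_mul_of_nonneg_right (Real.sqrt_le_sqrt ?_) (Real.sqrt_nonneg _))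
  -- compare the majorants: `(2B₀)^{4-4/q} ≤ 16 B₀^{4-4/q}` and `V_c(t) ≤ V_c(T)`
  have hpow : (2 * B₀) ^ (4 - 4 / q) ≤ 16 * B₀ ^ (4 - 4 / q) := by
    rw [Real.mul_rpow (by norm_num) hB₀.le]
    refine mul_le_mul_of_nonneg_right ?_ (by positivity)
    calc (2 : ℝ) ^ (4 - 4 / q) ≤ (2 : ℝ) ^ (4 : ℝ) :=
          Real.rpow_le_rpow_of_exponent_le (by norm_num) h4q
      _ = 16 := by norm_num
  have hVfin : (∫⁻ τ in Ioo 0 T, volume {x | c < ‖u τ x‖}) ≠ ⊤ :=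
    levelSetModeration_highSetMeasure_ne_top hν.le hLH hc
  have hV : (∫⁻ τ in Ioo 0 t, volume {x | c < ‖u τ x‖}).toReal ^ (1 - 2 / q) ≤
      (∫⁻ τ in Ioo 0 T, volume {x | c < ‖u τ x‖}).toReal ^ (1 - 2 / q) :=
    Real.rpow_le_rpow ENNReal.toReal_nonneg
      (ENNReal.toReal_mono hVfin (lintegral_mono_set (Ioo_subset_Ioo le_rfl ht.2.le))) hθ0
  have ht2 : 0 ≤ t ^ (2 / q) := Real.rpow_nonneg ht.1 _
  have hE2 : 0 ≤ E₀ ^ (2 / q) := Real.rpow_nonneg hE0 _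
  calc C * (2 * B₀) ^ (4 - 4 / q) * E₀ ^ (2 / q) * t ^ (2 / q) *
        (∫⁻ τ in Ioo 0 t, volume {x | c < ‖u τ x‖}).toReal ^ (1 - 2 / q)
      ≤ C * (16 * B₀ ^ (4 - 4 / q)) * E₀ ^ (2 / q) * t ^ (2 / q) *
        (∫⁻ τ in Ioo 0 T, volume {x | c < ‖u τ x‖}).toReal ^ (1 - 2 / q) := by
        gcongr
    _ = 16 * C * B₀ ^ (4 - 4 / q) * E₀ ^ (2 / q) * t ^ (2 / q) *
        (∫⁻ τ in Ioo 0 T, volume {x | c < ‖u τ x‖}).toReal ^ (1 - 2 / q) := by ring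

/-- **The Hölder pairing bound** (closed form of `levelSetModeration_pairing_le_holder`, registered
sub-goal of the crux item): for every `q > 2` there is `C ≥ 0` such that for every classical
Leray–Hopf solution on `ℝ³ × [0,T)` from a rapidly decaying datum with `∫|u₀|² ≤ E`, every `c > 0`,
`t ∈ [0,T)` and every speed bound `|u| ≤ G` on `(0,t) × ℝ³`,
`-∫₀ᵗ∫ (1 - c/|u|)₊ D(p̃[u τ])(u) ≤ √(C G^{4-4/q} E^{2/q} t^{2/q} V_c(t)^{1-2/q}) √(D_c(T))`.
[cite: Stein1971, Ch. II §4.2 Thm 3 (b)] -/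
theorem levelSetModeration_pairingHolder :
    ∀ (q : ℝ), 2 < q → ∃ C : ℝ, 0 ≤ C ∧ ∀ (ν T : ℝ) (u : ℝ → EuclideanSpace ℝ (Fin 3) → EuclideanSpace ℝ (Fin 3)) (p : ℝ → EuclideanSpace ℝ (Fin 3) → ℝ), 0 < ν → 0 < T → Literature.Analysis.FluidPDE.IsClassicalNSSolutionOn (Set.Ico 0 T) ν 0 u p → Literature.Analysis.FluidPDE.IsLerayHopfOn T ν 0 (u 0) u → Literature.Analysis.FluidPDE.HasRapidSpatialDecay (u 0) → ∀ (E G c t : ℝ), (∫ x, ‖u 0 x‖ ^ 2) ≤ E → 0 ≤ G → 0 < c → t ∈ Set.Ico 0 T → (∀ τ ∈ Set.Ioo 0 t, ∀ x, ‖u τ x‖ ≤ G) → -(∫ τ in Set.Ioo 0 t, ∫ x, max (1 - c / ‖u τ x‖) 0 * (fderiv ℝ (Literature.Analysis.FluidPDE.normalisedPressure (u τ)) x (u τ x))) ≤ Real.sqrt (C * G ^ (4 - 4 / q) * E ^ (2 / q) * t ^ (2 / q) * (∫⁻ τ in Set.Ioo 0 t, MeasureTheory.volume {x | c < ‖u τ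 x‖}).toReal ^ (1 - 2 / q)) * Real.sqrt ((∫⁻ τ in Set.Ioo 0 T, ∫⁻ x, Set.indicator {x | c < ‖u τ x‖} (fun x => ENNReal.ofReal (‖fderiv ℝ (fun y => ‖u τ y‖) x‖ ^ 2)) x).toReal) :=
  fun _ hq => levelSetModeration_pairing_le_holder hq

/-- **The Hölder pairing bound in the early window, unconditionally** (closed form of
`levelSetModeration_earlyPairing_le_holder`, registered sub-goal of the crux item): for every
`q > 2` there are `C ≥ 0`, `ε > 0` such that every classical Leray–Hopf solution on `ℝ³ × [0,T)`
from a rapidly decaying datum with `∫|u₀|² ≤ E₀`, `|u₀| ≤ B₀` (`B₀ > 0`) satisfies, for all `c > 0`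
and `t ∈ [0,T)` with `t ≤ ε ν/B₀²`,
`-∫₀ᵗ∫ (1 - c/|u|)₊ D(p̃[u τ])(u) ≤ √(C B₀^{4-4/q} E₀^{2/q} t^{2/q} V_c(T)^{1-2/q}) √(D_c(T))`.
[cite: Stein1971, Ch. II §4.2 Thm 3 (b)] -/
theorem levelSetModeration_earlyPairingHolder :
    ∀ (q : ℝ), 2 < q → ∃ C ε : ℝ, 0 ≤ C ∧ 0 < ε ∧ ∀ (ν T : ℝ) (u : ℝ → EuclideanSpace ℝ (Fin 3) → EuclideanSpace ℝ (Fin 3)) (p : ℝ → EuclideanSpace ℝ (Fin 3) → ℝ), 0 < ν → 0 < T → Literature.Analysis.FluidPDE.IsClassicalNSSolutionOn (Set.Ico 0 T) ν 0 u p → Literature.Analysis.FluidPDE.IsLerayHopfOn T ν 0 (u 0) u → Literature.Analysis.FluidPDE.HasRapidSpatialDecay (u 0) → ∀ (E₀ B₀ : ℝ), (∫ x, ‖u 0 x‖ ^ 2) ≤ E₀ → 0 < B₀ → (∀ x, ‖u 0 x‖ ≤ B₀) → ∀ (c t : ℝ), 0 < c → t ∈ Set.Ico 0 T → t ≤ ε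 * ν / B₀ ^ 2 → -(∫ τ in Set.Ioo 0 t, ∫ x, max (1 - c / ‖u τ x‖) 0 * (fderiv ℝ (Literature.Analysis.FluidPDE.normalisedPressure (u τ)) x (u τ x))) ≤ Real.sqrt (C * B₀ ^ (4 - 4 / q) * E₀ ^ (2 / q) * t ^ (2 / q) * (∫⁻ τ in Set.Ioo 0 T, MeasureTheory.volume {x | c < ‖u τ x‖}).toReal ^ (1 - 2 / q)) * Real.sqrt ((∫⁻ τ in Set.Ioo 0 T, ∫⁻ x, Set.indicator {x | c < ‖u τ x‖} (fun x => ENNReal.ofReal (‖fderiv ℝ (fun y => ‖u τ y‖) x‖ ^ 2)) x).toReal) :=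
  fun _ hq => levelSetModeration_earlyPairing_le_holder hq

end Summit.NavierStokesRegularity.NavierStokesRegularity.Theorems

end
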